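import Summits.PneNP.PneNP.Theorems.ChebyshevTracialDesignDipoleHitEigen
import HarnessLib

/-!
# Cell pnp-psdrank, route `ChebyshevTracialDesign`: the dipole hit bound in NORMALISED form —
# `λ_{2κ}(c)/λ₀(c) ≤ P_M[all dipoles hit] / E_U[φ²]`, explicit

Harmonic backbone of the `r = 1` rung of the crux `TracialDecayExp20` (stmt-PneNP-19878). The eigenvalue bound
`…DipoleHitEigen.kernelEigen_level_le_of_hit` divided by the valency eigenvalue `λ₀ = d_R·d_C` of a biregular Gram kernel
(lit's `kernelEigen_zero_eq_rowSum_mul_colSum`, handshake `choose_mul_rowSum_eq_card_mul_colSum`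
[cite: BrouwerHaemers2012, Prop. 4.3.2 / Thm. 4.9.1]) and the closed form of the ladder constant
`Π_{i<t−j} ladder n j i = ((t−j)!)²·C(n−2j, t−j)` [cite: MacWilliamsSloane1977, Ch. 21 §6 Thm. 10 (PDF p. 516)]:
* `prod_ladder_eq` : the ladder product in closed form;
* `card_pmatch_eq_pmCount` : `|PMatch n| = pmCount n`;
* `kernelEigen_ratio_le_of_hit` : for the level-`c` incidence `A = 1[#cr(U,M) = c]` on the `t`-sets with Gram class function `k`,
  constant column sums `d_C` and a row sum `d_R > 0` (`2κ ≤ t ≤ n/2`, injective disjoint dipoles):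
  `kernelEigen n t (2κ) k ≤ kernelEigen n t 0 k · [C(4κ,2κ)·pm(2κ)·pm(n−2κ)/pm(n)] · [C(n,t)/(4^κ·C(n−4κ,t−2κ))]`
  — eng g6's (B) `σ_{2κ}(c)² ≤ P_M[all dipoles hit]/E_U[φ²]` with the hit probability bounded by `C(4κ,2κ)(2κ−1)‼/((n−1)(n−3)⋯(n−2κ+1))`
  and `E_U[φ²] = 4^κ·C(n−4κ,t−2κ)/C(n,t)`, UNIFORMLY in the level `c`: the (ATT) shape `(O(κ)/n)^κ` for balanced `t`.
WHAT THIS IS NOT: not (L2)/SNT, nothing on psd rank; constants not optimised. Supports crux stmt-PneNP-19878.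
-/

set_option linter.dupNamespace false -- `Summit.PneNP.PneNP.…`: summit = sub-problem (D-0017)

namespace Summit.PneNP.PneNP.Theorems.ChebyshevTracialDesignDipoleHitRatio

open Finset Literature.Barriers.PneNP Literature.Combinatorics.AssociationSchemes
open Literature.Combinatorics.AssociationSchemes.JohnsonHarmonics
open Literature.Combinatorics.AssociationSchemes.JohnsonSpectrum
open Summit.PneNP.PneNP.Theorems.ChebyshevTracialDesignClosedPairCount
open Summit.PneNP.PneNP.Theorems.ChebyshevTracialDesignDipoleHitEigen

variable {n : ℕ}

/-- **Closed form of the ladder constant**: `Π_{i<m} ladder n j i = m!·m!·C(n−2j, m)` for `m + 2j ≤ n`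
(`ladder n j i = (i+1)(n−2j−i)`). [cite: MacWilliamsSloane1977, Ch. 21 §6 Thm. 10 (PDF p. 516)] -/
theorem prod_ladder_eq {j m : ℕ} (h : m + 2 * j ≤ n) :
    ∏ i ∈ range m, ladder n j i = ((m.factorial : ℕ) : ℝ) * (m.factorial : ℕ) * ((n - 2 * j).choose m : ℕ) := by
  have h1 : ∏ i ∈ range m, ladder n j i =
      (∏ i ∈ range m, ((i + 1 : ℕ) : ℝ)) * ∏ i ∈ range m, (((n - 2 * j - i : ℕ) : ℝ)) := by
    rw [← prod_mul_distrib]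
    refine prod_congr rfl fun i hi => ?_
    have hi' := mem_range.1 hi
    rw [ladder]
    push_cast [show i ≤ n - 2 * j by omega, show 2 * j ≤ n by omega]
    ring
  rw [h1, ← Nat.cast_prod, ← Nat.cast_prod, Finset.prod_range_add_one_eq_factorial, ← Nat.descFactorial_eq_prod_range,
    Nat.descFactorial_eq_factorial_mul_choose]
  push_cast
  ring

/-- `|PMatch n| = pmCount n`. [folklore] -/
theorem card_pmatch_eq_pmCount : Fintype.card (PMatch n) = pmCount n := by
  classical
  rw [pmCount]
  exact Fintype.card_of_subtype (perfectMatchings (univ : Finset (Fin n))) fun M => mem_perfectMatchings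

variable {κ : ℕ} {a b : Fin (2 * κ) → Fin n}

/-- **Normalised dipole hit bound (uniform in the level).** For `2κ ≤ t ≤ n/2`, injective disjoint dipoles, a level `c`,
the level-`c` incidence `A(U,M) = 1[#cr(U,M) = c]` on the `t`-sets with Gram class function `k` (`hA`), constant column sums
`d_C` (`hcol`: every matching has `d_C` cuts of size `t` at level `c`) and a `t`-cut `U₀` with row sum `d_R > 0` (`hrow`):
`kernelEigen n t (2κ) k ≤ kernelEigen n t 0 k · (C(4κ,2κ)·pm(2κ)·pm(n−2κ)/pm(n)) · (C(n,t)/(4^κ·C(n−4κ,t−2κ)))`.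
[cite: BrouwerHaemers2012, Prop. 4.3.2] -/
theorem kernelEigen_ratio_le_of_hit {t : ℕ} (hκt : 2 * κ ≤ t) (ht : 2 * t ≤ n)
    (ha : Function.Injective a) (hb : Function.Injective b) (hab : ∀ i j, a i ≠ b j) (c : ℕ) (k : ℕ → ℝ)
    (hA : ∀ U ∈ univ.powersetCard t, ∀ U' ∈ univ.powersetCard t,
      ∑ M : PMatch n, (if (M.1.filter fun e => cutCount U e = 1).card = c then (1 : ℝ) else 0) *
        (if (M.1.filter fun e => cutCount U' e = 1).card = c then (1 : ℝ) else 0) = k (U ∩ U').card)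
    {dC dR : ℝ}
    (hcol : ∀ M : PMatch n,
      ∑ U ∈ univ.powersetCard t, (if (M.1.filter fun e => cutCount U e = 1).card = c then (1 : ℝ) else 0) = dC)
    {U₀ : Finset (Fin n)} (hU₀ : U₀.card = t)
    (hrow : ∑ M : PMatch n, (if (M.1.filter fun e => cutCount U₀ e = 1).card = c then (1 : ℝ) else 0) = dR)
    (hdR : 0 < dR) :
    kernelEigen n t (2 * κ) k ≤
      kernelEigen n t 0 k *
        ((((4 * κ).choose (2 * κ) * pmCount (2 * κ) * pmCount (n - 2 * κ) : ℕ) : ℝ) / (pmCount n : ℕ)) *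
        ((n.choose t : ℝ) / ((4 : ℝ) ^ κ * ((n - 4 * κ).choose (t - 2 * κ) : ℕ))) := by
  classical
  set N : ℕ := (4 * κ).choose (2 * κ) * pmCount (2 * κ) * pmCount (n - 2 * κ) with hN
  -- the level classes have exactly `dC` elements
  have hB : ∀ M : PMatch n,
      (((univ.powersetCard t).filter (fun U : Finset (Fin n) => (M.1.filter fun e => cutCount U e = 1).card = c)).card : ℝ) ≤ dC := by
    intro M
    rw [← hcol M, ← sum_boole]
  have hE := kernelEigen_level_le_of_hit hκt ht ha hb hab c k hA hB
  -- λ₀ = dR · dC and the handshake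
  have h0 : kernelEigen n t 0 k = dR * dC := kernelEigen_zero_eq_rowSum_mul_colSum _ k hA hcol hU₀ hrow
  have hdC : (n.choose t : ℝ) * dR = (pmCount n : ℕ) * dC := by
    have hrow' : ∀ U ∈ univ.powersetCard t,
        ∑ M : PMatch n, (if (M.1.filter fun e => cutCount U e = 1).card = c then (1 : ℝ) else 0) = dR := by
      intro U hU
      have hUt := (mem_powersetCard.1 hU).2
      -- row sums are constant: read them off the Gram kernel at `U ∩ U = U`
      have h1 := hA U hU U hU
      have h2 := hA U₀ (mem_powersetCard_univ.2 hU₀) U₀ (mem_powersetCard_univ.2 hU₀)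
      rw [inter_self, hUt] at h1
      rw [inter_self, hU₀] at h2
      have hsq : ∀ (M : PMatch n) (V : Finset (Fin n)),
          (if (M.1.filter fun e => cutCount V e = 1).card = c then (1 : ℝ) else 0) *
            (if (M.1.filter fun e => cutCount V e = 1).card = c then (1 : ℝ) else 0) =
          (if (M.1.filter fun e => cutCount V e = 1).card = c then (1 : ℝ) else 0) := by
        intro M V; split_ifs <;> simp
      simp only [hsq] at h1 h2
      rw [h1, ← h2, hrow]
    have := choose_mul_rowSum_eq_card_mul_colSum _ hcol hrow'
    rwa [card_pmatch_eq_pmCount] at this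
  -- positivity of the constants
  have hL : ∏ i ∈ range (t - 2 * κ), ladder n (2 * κ) i =
      (((t - 2 * κ).factorial : ℕ) : ℝ) * ((t - 2 * κ).factorial : ℕ) * ((n - 2 * (2 * κ)).choose (t - 2 * κ) : ℕ) :=
    prod_ladder_eq (by omega)
  have h22 : n - 2 * (2 * κ) = n - 4 * κ := by omega
  rw [h22] at hL
  have hchoose : 0 < (((n - 4 * κ).choose (t - 2 * κ) : ℕ) : ℝ) := by
    exact_mod_cast Nat.choose_pos (by omega)
  have hfact : 0 < (((t - 2 * κ).factorial : ℕ) : ℝ) := by exact_mod_cast Nat.factorial_pos _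
  have hCnt : 0 < (n.choose t : ℝ) := by exact_mod_cast Nat.choose_pos (by omega)
  have hpm : 0 < ((pmCount n : ℕ) : ℝ) := by
    have h1 : 0 < ((pmCount n : ℕ) : ℝ) * dC := by rw [← hdC]; exact mul_pos hCnt hdR
    rcases (Nat.cast_nonneg (pmCount n) : (0 : ℝ) ≤ _).eq_or_lt with h | h
    · rw [← h, zero_mul] at h1; exact absurd h1 (lt_irrefl 0)
    · exact h
  have h4 : (2 : ℝ) ^ (2 * κ) = 4 ^ κ := by rw [pow_mul]; norm_num
  -- the two sides agree after `λ₀ = dR·dC`, the handshake and the closed form of the ladder constant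
  refine hE.trans (le_of_eq ?_)
  rw [hL, h4, h0]
  have hkey : dR * dC * ((N : ℕ) / ((pmCount n : ℕ) : ℝ)) * ((n.choose t : ℝ) / ((4 : ℝ) ^ κ * ((n - 4 * κ).choose (t - 2 * κ) : ℕ))) =
      ((n.choose t : ℝ) * dR) * dC * (N : ℕ) / (((pmCount n : ℕ) : ℝ) * ((4 : ℝ) ^ κ * ((n - 4 * κ).choose (t - 2 * κ) : ℕ))) := by
    field_simp
  rw [hkey, hdC]
  field_simp
  ring

end Summit.PneNP.PneNP.Theorems.ChebyshevTracialDesignDipoleHitRatio
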